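import Summits.BirchSwinnertonDyer.Rank1Residual.Additive.TameBranchOfTwistPartner
import Summits.BirchSwinnertonDyer.Rank1Residual.Additive.TwistPartnerRigidity
import Mathlib.NumberTheory.JacobiSum.Basic
import HarnessLib

/-!
# The tame-branch measure of an ordinary twist partner at LEVEL ONE: the rows `∫1`, `∫ψ`
# (`ψ ∉ {1, ε}`: a Jacobi sum) and `∫ε` (Delbourgo's multiplier `(1 − ã⁻¹)(1 − ã/p)⁻¹`)
# (cell `b2b-bsdres`, sub-cell additive-p2 = X3♯(G-ord)/X4♯(G-ord), gen 25; sequel of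
# `TameBranchOfTwistPartner.lean` §3, whose `sum_mul_twistPartnerMeasure_eq` gives the rows at every
# PRIMITIVE character of conductor `p^m`, `m ≥ 2`)

HONEST FRAMING (cell `b2b-bsdres`, run/shared/lean/b2b/bsd-rank1-residual/, verbatim in every
file): the goal of the cell is to DELETE the COMBINATION-SHAPED residual classes of the
Birch–Swinnerton-Dyer formula for ALL analytic-rank `≤ 1` elliptic curves over `ℚ` — "full BSD
formula for every rank `≤ 1` curve in class `C`" assembled STRICTLY from published theorems — so
that the rank-`≤ 1` remainder becomes exactly the CONSTRUCTION-SHAPED classes, which are TYPED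
(missing-input `Prop`s), NOT attempted. This is not "finishing BSD". Sub-cell additive-p2: the
classes X3♯(G-ord) / X4♯(G-ord) are CONSTRUCTION-SHAPED and stay so; labels / RESIDUAL-MAP marks
UNCHANGED; nothing is booked. Theorems only (character-sum algebra); no definition, no named fact.

For an ordinary twist partner `(Φ, ã)` of `(x, χ)` (`Φ` `1`-periodic, (α) `x = τ_{χ⁻¹}Φ`,
(β) `∑_d Φ(· + d/p) = ã Φ(p·)`, `χ ≠ 1`, `‖ã‖ = 1`) the measure `μ(a + pⁿℤ_p) = ã⁻ⁿ χ̄(a) Φ(a/pⁿ)`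
(`twistPartnerMeasure χ Φ ã (x 0)`) has, at LEVEL ONE (characters `ψ` of `ℤ/p`, read at level `p^1`
of the tower to match the currency `μ : (n : ℕ) → ZMod (p^n) → _`), the rows
* (T0) `∑_b μ(b + pℤ_p) = ã⁻¹·x(0)` (`twistPartnerMeasure_level_one_one`);
* (T1) `ψ ∉ {1, ε}`: `∑_b ψ(b)μ(b + pℤ_p) = ã⁻¹·χ(−1)·p⁻¹·J(ε, ψε̄)·∑_b ψ(b)x(b/p)`, `J` = Mathlib
  `jacobiSum` — from `Φ(b/p) = S(b/p) + (ã/p)Φ(0)` (`TwistPartner.eq_source_add_mul`),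
  `∑_b (ψε̄)(b) = 0` and `∑_c ψ(c)ε̄(c)ε(d − c) = ψ(d)·J(ε, ψε̄)` (`twistPartnerMeasure_level_one_of_ne`);
* (Tε) `ψ = ε`: `∑_b ε(b)μ(b + pℤ_p) = (1 − ã⁻¹)(1 − ã/p)⁻¹·χ(−1)·p⁻¹·∑_b ε(b)x(b/p)` — from (β) at
  `s = 0` and `Φ(0) = S(0)/(1 − ã/p)` (`TwistPartner.apply_intCast_eq`): the ONLY row where
  Delbourgo's multiplier `L^{(G)}_p(1) = (1 − α_p⁻¹)(1 − α_p/p)⁻¹` appears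
  (`twistPartnerMeasure_level_one_self`).
No parity hypothesis. USE (`TwistPartnerForcedOfMeasure.lean`, same gen): with
`sum_mul_twistPartnerMeasure_eq` and the distribution relation these rows CHARACTERISE the measure of
the forced partner level by level, so a bounded distribution with the same rows — the named fact
`Delbourgo1998.thm1_exists_bounded_evenMeasure` (Delbourgo 1998 Thm. 1) — forces tower boundedness of
the forced partner. Nothing booked.

References: B. Mazur, J. Tate, J. Teitelbaum, Invent. Math. 84 (1986) §I.8, §I.10 (10.1)–(10.2)
[MazurTateTeitelbaum1986Invent]; D. Delbourgo, Compositio Math. 113 (1998) §1.4–1.5, Thm. 1 and the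
multiplier `L^{(G)}_p` (p. 131) [Delbourgo1998].
-/

noncomputable section

open scoped Classical MatrixGroups ModularForm

open CongruenceSubgroup

namespace Summit.BirchSwinnertonDyer.Rank1Residual.Additive

open Literature.NumberTheory.EllipticCurves Literature.NumberTheory.EllipticCurves.ModularForms
  Literature.NumberTheory.EllipticCurves.Rank1Residual

namespace TwistPartner

/-! ### §1 Character-sum algebra on `ℤ/p` -/

section Algebra

variable {p : ℕ} [hp : Fact p.Prime]

/-- **The inner character sum**: for multiplicative characters `ψ ≠ 1` and `ε` of the field `ℤ/p`
(values in any commutative ring... here `ℂ_p`) and every `d`,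
`∑_c ψ(c)·ε̄(c)·ε(d − c) = ψ(d) · J(ε, ψε̄)` (`J` = Mathlib `jacobiSum`): for `d ≠ 0` substitute
`c = d·t`; for `d = 0` both sides vanish (`∑_c ψ(c) = 0`). [folklore] -/
theorem sum_mul_inv_mul_apply_sub_eq {ψ ε : MulChar (ZMod p) ℂ_[p]} (hψ : ψ ≠ 1) (d : ZMod p) :
    ∑ c : ZMod p, ψ c * ε⁻¹ c * ε (d - c) = ψ d * jacobiSum ε (ψ * ε⁻¹) := by
  have hunit : ∀ c : ZMod p, IsUnit c → ε⁻¹ c * ε c = 1 := fun c hc ↦ by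
    rw [← Pi.mul_apply, ← MulChar.coeToFun_mul, inv_mul_cancel, MulChar.one_apply hc]
  by_cases hd : d = 0
  · subst hd
    have h1 : ∀ c : ZMod p, ψ c * ε⁻¹ c * ε (0 - c) = ε (-1) * ψ c := by
      intro c
      by_cases hc : IsUnit c
      · rw [zero_sub, show -c = -1 * c by ring, map_mul]
        linear_combination (ε (-1) * ψ c) * hunit c hc
      · rw [MulChar.map_nonunit ψ hc, zero_mul, zero_mul, mul_zero]
    simp_rw [h1]
    rw [← Finset.mul_sum, MulChar.sum_eq_zero_of_ne_one hψ, mul_zero,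
      MulChar.map_nonunit ψ not_isUnit_zero, zero_mul]
  · have hdU : IsUnit d := isUnit_iff_ne_zero.mpr hd
    have hbij : Function.Bijective fun t : ZMod p ↦ d * t :=
      (Units.mulLeft hdU.unit).bijective
    rw [← Fintype.sum_bijective _ hbij (fun t ↦ ψ (d * t) * ε⁻¹ (d * t) * ε (d - d * t)) _
      fun t ↦ rfl]
    have h2 : ∀ t : ZMod p, ψ (d * t) * ε⁻¹ (d * t) * ε (d - d * t) =
        ψ d * ((ψ * ε⁻¹) t * ε (1 - t)) := by
      intro t
      rw [show d - d * t = d * (1 - t) by ring, map_mul, map_mul, map_mul, MulChar.coeToFun_mul,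
        Pi.mul_apply]
      linear_combination (ψ d * ψ t * ε⁻¹ t * ε (1 - t)) * hunit d hdU
    simp_rw [h2]
    rw [← Finset.mul_sum, jacobiSum_comm]
    rfl

end Algebra

/-! ### §2 The three level-one rows at level `p` (characters of `ℤ/p`) -/

section LevelP

variable {p : ℕ} [hp : Fact p.Prime] {χ : MulChar (ZMod p) ℚ_[p]} {Φ x : ℚ → ℚ_[p]} {ã : ℚ_[p]}

/-- `x = τ_{χ⁻¹}Φ` is `1`-periodic when `Φ` is. [folklore] -/
theorem periodic_of_eq_twist_inv (hper : ∀ s, Φ (s + 1) = Φ s)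
    (hx : ∀ s, x s = ∑ c : ZMod p, χ⁻¹ c * Φ (s + (c.val : ℚ) / p)) (s : ℚ) : x (s + 1) = x s := by
  rw [hx, hx]
  refine Finset.sum_congr rfl fun c _ ↦ ?_
  rw [add_right_comm, hper]

/-- The functional equation at the level-one points: `Φ(c/p) = (χ(−1)/p)·τ_χ x(c/p) + (ã/p)·Φ(0)`.
[cite: MazurTateTeitelbaum1986Invent, §I.10 (10.1)] -/
theorem apply_val_div_eq (hχ : χ ≠ 1) (hper : ∀ s, Φ (s + 1) = Φ s)
    (hx : ∀ s, x s = ∑ c : ZMod p, χ⁻¹ c * Φ (s + (c.val : ℚ) / p))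
    (hU : ∀ s, ∑ d : ZMod p, Φ (s + (d.val : ℚ) / p) = ã * Φ (p * s)) (c : ZMod p) :
    Φ ((c.val : ℚ) / p) =
      χ (-1) / p * CensusX43.twist χ x ((c.val : ℚ) / p) + ã / p * Φ 0 := by
  have hp0 : (p : ℚ) ≠ 0 := Nat.cast_ne_zero.mpr hp.out.ne_zero
  have h := eq_source_add_mul hχ hper (fun s ↦ hx s) hU ((c.val : ℚ) / p)
  have hc : Φ ((c.val : ℕ) : ℚ) = Φ 0 := by
    have h' := CensusX43.periodic_natCast hper 0 c.val
    rwa [zero_add] at h'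
  rwa [mul_div_cancel₀ _ hp0, hc] at h

/-- The twist at a level-one point, re-indexed: `ι τ_χ x(c/p) = ∑_d ι χ(d − c) · ι x(d/p)`. [folklore] -/
theorem algebraMap_twist_val_div_eq (hper : ∀ s, Φ (s + 1) = Φ s)
    (hx : ∀ s, x s = ∑ c : ZMod p, χ⁻¹ c * Φ (s + (c.val : ℚ) / p)) (c : ZMod p) :
    algebraMap ℚ_[p] ℂ_[p] (CensusX43.twist χ x ((c.val : ℚ) / p)) =
      ∑ d : ZMod p, algebraMap ℚ_[p] ℂ_[p] (χ (d - c)) *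
        algebraMap ℚ_[p] ℂ_[p] (x ((d.val : ℚ) / p)) := by
  have hperx := periodic_of_eq_twist_inv hper hx
  simp only [CensusX43.twist, map_sum, map_mul]
  have h1 : ∀ b : ZMod p, x ((c.val : ℚ) / p + (b.val : ℚ) / p) = x (((c + b).val : ℚ) / p) := by
    intro b
    rw [CensusX43.val_div_add_val_div, CensusX43.periodic_natCast hperx]
  simp_rw [h1]
  exact Fintype.sum_equiv (Equiv.addLeft c) _ _ fun b ↦ by
    simp only [Equiv.coe_addLeft, add_sub_cancel_left]

/-- **Row (T1) at level `p`.** For `ψ ∉ {1, ι∘χ}`: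
`∑_c ψ(c)·ι χ̄(c)·ι Φ(c/p) = ι(χ(−1)/p) · J(ι∘χ, ψ·(ι∘χ)⁻¹) · ∑_c ψ(c)·ι x(c/p)`. [folklore] -/
theorem sum_mul_inv_mul_apply_div_eq (hχ : χ ≠ 1) (hper : ∀ s, Φ (s + 1) = Φ s)
    (hx : ∀ s, x s = ∑ c : ZMod p, χ⁻¹ c * Φ (s + (c.val : ℚ) / p))
    (hU : ∀ s, ∑ d : ZMod p, Φ (s + (d.val : ℚ) / p) = ã * Φ (p * s))
    {ψ : MulChar (ZMod p) ℂ_[p]} (hψ1 : ψ ≠ 1)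
    (hψε : ψ ≠ χ.ringHomComp (algebraMap ℚ_[p] ℂ_[p])) :
    ∑ c : ZMod p, ψ c * algebraMap ℚ_[p] ℂ_[p] (χ⁻¹ c) *
        algebraMap ℚ_[p] ℂ_[p] (Φ ((c.val : ℚ) / p)) =
      algebraMap ℚ_[p] ℂ_[p] (χ (-1) / p) *
        jacobiSum (χ.ringHomComp (algebraMap ℚ_[p] ℂ_[p]))
          (ψ * (χ.ringHomComp (algebraMap ℚ_[p] ℂ_[p]))⁻¹) *
        ∑ c : ZMod p, ψ c * algebraMap ℚ_[p] ℂ_[p] (x ((c.val : ℚ) / p)) := by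
  set ε : MulChar (ZMod p) ℂ_[p] := χ.ringHomComp (algebraMap ℚ_[p] ℂ_[p]) with hε
  have hεinv : ∀ c : ZMod p, algebraMap ℚ_[p] ℂ_[p] (χ⁻¹ c) = ε⁻¹ c := fun c ↦ by
    rw [hε, MulChar.ringHomComp_inv]; rfl
  have hεapp : ∀ c : ZMod p, algebraMap ℚ_[p] ℂ_[p] (χ c) = ε c := fun c ↦ rfl
  -- the tame sum `∑_c ψ(c) ε̄(c) = 0`
  have hvan : ∑ c : ZMod p, ψ c * ε⁻¹ c = 0 := by
    have hne : ψ * ε⁻¹ ≠ 1 := fun h ↦ hψε (mul_inv_eq_one.mp h)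
    have h := MulChar.sum_eq_zero_of_ne_one hne
    have h' : ∀ c : ZMod p, (ψ * ε⁻¹) c = ψ c * ε⁻¹ c := fun c ↦ by
      rw [MulChar.coeToFun_mul, Pi.mul_apply]
    simpa only [h'] using h
  -- expand `Φ(c/p)` by the functional equation
  have h1 : ∀ c : ZMod p, ψ c * algebraMap ℚ_[p] ℂ_[p] (χ⁻¹ c) *
      algebraMap ℚ_[p] ℂ_[p] (Φ ((c.val : ℚ) / p)) =
      algebraMap ℚ_[p] ℂ_[p] (χ (-1) / p) * (ψ c * ε⁻¹ c *
        ∑ d : ZMod p, algebraMap ℚ_[p] ℂ_[p] (χ (d - c)) *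
          algebraMap ℚ_[p] ℂ_[p] (x ((d.val : ℚ) / p))) +
        algebraMap ℚ_[p] ℂ_[p] (ã / p) * algebraMap ℚ_[p] ℂ_[p] (Φ 0) * (ψ c * ε⁻¹ c) := by
    intro c
    rw [apply_val_div_eq hχ hper hx hU c, map_add, map_mul, map_mul, hεinv,
      algebraMap_twist_val_div_eq hper hx]
    ring
  have h2 : ∀ d : ZMod p, ∑ c : ZMod p, ψ c * ε⁻¹ c *
      (algebraMap ℚ_[p] ℂ_[p] (χ (d - c)) * algebraMap ℚ_[p] ℂ_[p] (x ((d.val : ℚ) / p))) =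
      jacobiSum ε (ψ * ε⁻¹) * (ψ d * algebraMap ℚ_[p] ℂ_[p] (x ((d.val : ℚ) / p))) := by
    intro d
    have h3 : ∑ c : ZMod p, ψ c * ε⁻¹ c *
        (algebraMap ℚ_[p] ℂ_[p] (χ (d - c)) * algebraMap ℚ_[p] ℂ_[p] (x ((d.val : ℚ) / p))) =
        (∑ c : ZMod p, ψ c * ε⁻¹ c * ε (d - c)) * algebraMap ℚ_[p] ℂ_[p] (x ((d.val : ℚ) / p)) := by
      rw [Finset.sum_mul]
      exact Finset.sum_congr rfl fun c _ ↦ by rw [hεapp]; ring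
    rw [h3, sum_mul_inv_mul_apply_sub_eq hψ1 d]
    ring
  simp_rw [h1]
  rw [Finset.sum_add_distrib, ← Finset.mul_sum, ← Finset.mul_sum, hvan, mul_zero, add_zero]
  -- the twisted part: swap and use the inner character sum
  conv_rhs => rw [mul_assoc]
  congr 1
  simp_rw [Finset.mul_sum]
  rw [Finset.sum_comm]
  exact Finset.sum_congr rfl fun d _ ↦ h2 d

/-- **Row (Tε) at level `p`.** `∑_c ι χ(c)·ι χ̄(c)·ι Φ(c/p) = ι((ã − 1)(1 − ã/p)⁻¹ χ(−1)/p) · ∑_c ι χ(c)·ι x(c/p)`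
— from `∑_{c ≠ 0} Φ(c/p) = (ã − 1)Φ(0)` (the `U_p`-relation at `0`) and `Φ(0) = S(0)/(1 − ã/p)`.
[cite: Delbourgo1998, Theorem 1 (the multiplier L^{(G)}_p at the character ε)] -/
theorem sum_self_mul_inv_mul_apply_div_eq (hχ : χ ≠ 1) (hã : ‖ã‖ = 1)
    (hper : ∀ s, Φ (s + 1) = Φ s)
    (hx : ∀ s, x s = ∑ c : ZMod p, χ⁻¹ c * Φ (s + (c.val : ℚ) / p))
    (hU : ∀ s, ∑ d : ZMod p, Φ (s + (d.val : ℚ) / p) = ã * Φ (p * s)) :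
    ∑ c : ZMod p, algebraMap ℚ_[p] ℂ_[p] (χ c) * algebraMap ℚ_[p] ℂ_[p] (χ⁻¹ c) *
        algebraMap ℚ_[p] ℂ_[p] (Φ ((c.val : ℚ) / p)) =
      algebraMap ℚ_[p] ℂ_[p] ((ã - 1) * (1 - ã / p)⁻¹ * (χ (-1) / p)) *
        ∑ c : ZMod p, algebraMap ℚ_[p] ℂ_[p] (χ c) * algebraMap ℚ_[p] ℂ_[p] (x ((c.val : ℚ) / p)) := by
  set ι : ℚ_[p] →+* ℂ_[p] := algebraMap ℚ_[p] ℂ_[p] with hι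
  -- pull everything back to `ℚ_p`
  have hL : ∑ c : ZMod p, ι (χ c) * ι (χ⁻¹ c) * ι (Φ ((c.val : ℚ) / p)) =
      ι (∑ c : ZMod p, χ c * χ⁻¹ c * Φ ((c.val : ℚ) / p)) := by
    rw [map_sum]
    exact Finset.sum_congr rfl fun c _ ↦ by rw [map_mul, map_mul]
  have hR : ∑ c : ZMod p, ι (χ c) * ι (x ((c.val : ℚ) / p)) =
      ι (CensusX43.twist χ x 0) := by
    simp only [CensusX43.twist, map_sum, map_mul, zero_add]
  rw [hL, hR, ← map_mul]
  congr 1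
  -- `∑_c χ χ̄ Φ(c/p) = ∑_c Φ(c/p) − Φ(0) = (ã − 1) Φ(0)`
  have h1 : ∀ c : ZMod p, χ c * χ⁻¹ c * Φ ((c.val : ℚ) / p) =
      if c = 0 then 0 else Φ ((c.val : ℚ) / p) := by
    intro c
    split_ifs with hc
    · rw [hc, MulChar.map_nonunit χ not_isUnit_zero, zero_mul, zero_mul]
    · rw [← Pi.mul_apply, ← MulChar.coeToFun_mul, mul_inv_cancel,
        MulChar.one_apply (isUnit_iff_ne_zero.mpr hc), one_mul]
  simp_rw [h1]
  rw [Finset.sum_ite, Finset.sum_const_zero, zero_add, Finset.filter_ne',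
    Finset.sum_erase_eq_sub (Finset.mem_univ _), ZMod.val_zero, Nat.cast_zero, zero_div]
  have hU0 : ∑ c : ZMod p, Φ ((c.val : ℚ) / p) = ã * Φ 0 := by
    have h := hU 0
    simp only [zero_add, mul_zero] at h
    exact h
  rw [hU0]
  -- `Φ(0) = (1 − ã/p)⁻¹ · (χ(−1)/p · τ_χ x 0)`
  have h0 : Φ 0 = (1 - ã / p)⁻¹ * (χ (-1) / p * CensusX43.twist χ x 0) := by
    have h := apply_intCast_eq hχ hã hper (fun s ↦ hx s) hU 0
    rwa [Int.cast_zero] at h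
  rw [h0]
  ring

/-- **Row (T0) at level `p`**: `∑_c ι χ̄(c)·ι Φ(c/p) = ι x(0)` ((α) at `s = 0`). [folklore] -/
theorem sum_inv_mul_apply_div_eq (hx : ∀ s, x s = ∑ c : ZMod p, χ⁻¹ c * Φ (s + (c.val : ℚ) / p)) :
    ∑ c : ZMod p, algebraMap ℚ_[p] ℂ_[p] (χ⁻¹ c) * algebraMap ℚ_[p] ℂ_[p] (Φ ((c.val : ℚ) / p)) =
      algebraMap ℚ_[p] ℂ_[p] (x 0) := by
  rw [hx 0, map_sum]
  exact Finset.sum_congr rfl fun c _ ↦ by rw [map_mul, zero_add]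

end LevelP

end TwistPartner

end Summit.BirchSwinnertonDyer.Rank1Residual.Additive

end
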